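import Summits.Langlands.Langlands.Theorems.PicardMuOrdinaryMuOrdinaryFamilyRTPointModelCore
import Summits.Langlands.Langlands.Theorems.PicardMuOrdinaryMuOrdinaryFamilyRTPointModelBorel
import Summits.Langlands.Langlands.Theorems.PicardMuOrdinaryMuOrdinaryFamilyRTPointPolarized
import Summits.Langlands.Langlands.Theorems.PicardMuOrdinaryMuOrdinaryFamilyRTPointRoots

/-!
# The Picard point of line `free-seed-smooth-rt` (crux `MuOrdinaryFamilyRT`, stmt-Langlands-13757):
# the registered conditional stub `stub_point_of`

`S.stub_point` (for generic `f`, a `PicardBorelAt3 f ι e` representation and a residually distinguished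
flag give a point `PointData f ι e` of the universal ring of type `Δ`) from the three cited facts
`F1 = ordinaryPolarizedDeformationRing_nonempty`, `F2 = exists_descent_of_trace_mem_of_isAbsIrreducible_residual`,
`F3 = exists_conj_eq_of_trace_eq_of_isAbsIrreducible_residual`: the kernel-checked assembly
`stub_point_of_leaves` (`…Point.lean`) fed with the five leaves, all PROVED:
`rbarUnramified` (`…PointRoots.lean`), `rbarPolarized` (`…PointPolarized.lean`), `rbarAbsIrreducible`
(`…PointAbsIrr.lean`), `modelCore` (`…PointModelCore.lean`), `modelBorel` (`…PointModelBorel.lean`).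
-/

-- `Summit.Langlands.Langlands.…` (summit = sub-problem name, D-0017 layout) trips `dupNamespace` on every decl.
set_option linter.dupNamespace false

namespace Summit.Langlands.Langlands.Cruxes.MuOrdinaryFamilyRT.FreeSeedSmoothRt

/-- **The Picard point, conditional on `F1, F2, F3`** (registered stub `stub_point_of` of crux
`MuOrdinaryFamilyRT`, line `free-seed-smooth-rt`). -/
theorem stub_point_of : Literature.NumberTheory.GaloisRepresentations.ordinaryPolarizedDeformationRing_nonempty → Literature.NumberTheory.GaloisRepresentations.exists_descent_of_trace_mem_of_isAbsIrreducible_residual → Literature.NumberTheory.GaloisRepresentations.exists_conj_eq_of_trace_eq_of_isAbsIrreducible_residual → S.stub_point :=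
  stub_point_of_leaves rbarUnramified rbarPolarized rbarAbsIrreducible modelCore modelBorel

end Summit.Langlands.Langlands.Cruxes.MuOrdinaryFamilyRT.FreeSeedSmoothRt
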